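import Literature.MathematicalPhysics.QuantumFieldTheory.Balaban1983to89.B15Prop1Thm1RowsOfExistsUnique

/-!
# `Balaban1983to89.B15Prop1Thm1RowsOfExistsUniqueAtLength` — [Balaban1985Variational] = «[15]», Thm 1 p. 279, (1)–(7) pp. 277–278; [Balaban1988Convergent] = «[III]», (2.1) p. 254,
# (2.12)–(2.13) pp. 256–257, (2.18) p. 257; [Balaban1989LargeFieldI] = «[IV]», (1.74) p. 192, Prop. 1 p. 194: THE AT-LENGTH EDITION OF `B15Prop1Thm1RowsOfExistsUniquePos` §2 — the rows (E) and
# (T1@q₀) of the (J0′) producer for every base field, from the two [15]-Theorem-1 letters READ AT EACH INSTANCE's OWN LENGTH `k i` (no quantification over lengths)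

Honest framing: statement-level skeleton of published theorems with citation tags; proofs where landed; nothing here is a claim about the Yang–Mills mass gap.  Cell `pub-ymgap`
(HUMAN RULINGS D-0062 ∕ D-0149), seat `pub-ymgap-dag-n12-d` g26 (R134 seat (a), N12 = [B15], s2 «by-name knit at the record»), an EDITION of the lane `pub-ymgap-dag-n12-c` g29's
`B15Prop1Thm1RowsOfExistsUniquePos.thm1Rows_atZ_of_thm1TorusClass_existsUnique_pos` (p738064); count-neutral helper of K1⁹ `stmt-QuantumFields-27364` (`--kind proof --supports`);
N12 NOT discharged; one finite 𝕋⁴ programme at fixed ε; nothing continuum ∕ ℝ⁴ ∕ OS ∕ mass-gap ∕ Clay.  THEOREMS ONLY (0 `def`, 0 `instance`, 0 `sorry`).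

WHY.  The `_pos` edition displays the two closed [15]-Theorem-1 letters — (8) = `h15T` and existence ∕ uniqueness = `h15EUT⁺` — quantified over ALL lengths `k' ≤ m + K` (`0 < k'` for the
second), although its proof reads each letter exactly once, at the instance's own length `k' = k i`.  The producer of record of the (8)-letter is the K0 road: K0⁷ (stmt-QuantumFields-20541,
skeleton V22-Z) registers [15] Prop. 8's top step under the GRID GUARD `A‴(c, c₀, c₁)` (`K0V22ZDefs.Prop8StepCoPGridGAt`: numerics floor `c ≤ M₁`, level guard `k + c₀ ≤ m + K`, granularity
`L^{c₁} ∣ M`, torus-compatibility of the cube partitions), whence dag-n07-e's `variationalThm1RegSepCoP7MG_of_prop8TopStepG` gives the GUARDED (8)-sentence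
`Node00.VariationalThm1RegSepCoP7MG F 2 A‴ B₃ a₀ a₁` — which serves the torus-class (8)-letter ONLY AT LENGTHS PASSING THE GUARD, never at all `k' ≤ m + K`.  So a knit keyed by name on
the K0 road's token must read the letters AT ITS INSTANCE's LENGTH.  THIS FILE is that edition: the SAME theorem with `h15T : ∀ i, <(8)-body at k' := k i>` and
`h15EUT : ∀ i, <(E∕U)-body at k' := k i>` (the `_pos` bodies byte for byte with `k'` read as `k i`; the antecedents `k' ≤ m + K`, `0 < k'`, `LᵏM₁ ∣ sitesPerDir 0` are the instance rows
`hk`, `hk0`, `hdiv` already displayed); the proof is the lane's VERBATIM but for the two letter calls (`h15T (k i) (hk i) (hdiv i) s' …` ↦ `h15T i s' …`, likewise `h15EUT`).  Any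
producer of either letter under ANY length ∕ prefix guard serves an instance whose rows pass the guard (dag-n12-d's `BalabanUVNodesN12Thm1LettersAtLengthOfK0GridG`); the `_pos` letters
serve every instance (instantiate at `k i`).

CONTENTS.  §1 `eta_pos` (private, re-proved); §2 ★★★ `thm1Rows_atZ_of_thm1TorusClass_existsUnique_atLength`.

HONEST SCOPE.  Bookkeeping by name over landed modules; [15] Theorem 1 ((8), existence ∕ uniqueness at the instance's length `k i ≥ 1`) stays DISPLAYED, nothing of Bałaban's asserted; the
uniqueness clause is the WEAKER tower-central one (central ⊇ residual); whether the (E∕U) letter is inhabited at the record's numerics is N07's ∕ NODE 00's business (no producer in the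
tree); count-neutral; N12 NOT discharged; K0⁷ ∕ K1⁹ NOT closed; counts unmoved; R4 closes only the conditional finite-𝕋⁴ rung `BalabanLadder.UV` — no summit statement is proved here and NOT
the Yang–Mills mass gap (Clay); nothing continuum ∕ ℝ⁴ ∕ OS.
-/

noncomputable section

open Set

namespace Literature.MathematicalPhysics.QuantumFieldTheory.Balaban1983to89.B15Prop1Thm1RowsOfExistsUniqueAtLength

open T4Continuum B15DeterminingSets GaugeField B15Prop1Carrier B8Eq17ClassAkV1 BlockAveraging
open B14.Eq22Determines (blockIter IsBlockUnion)
open Literature.MathematicalPhysics.QuantumFieldTheory.BalabanImbrieJaffe1984to88.BIJ85Eq453GaugeField (qsstarGIter0)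
open B15Prop1DatumSmall7AtZSequence B15Prop1Thm1GeneralFormAtZSequence B15Prop1Thm1GeneralFormShapes
open B16Sect1Backgrounds (toMS)
open B15Prop1Thm1RowsOfExistsUnique

/-! ## §1  `η_j > 0` -/

section Eta

variable {F : T4Family}

/-- `0 < η_j` (`η_j = L^{−j}`, `L ≥ 1`). [folklore] -/
private theorem eta_pos (K j : ℕ) : 0 < (F.P K).eta j := by
  have hL : (0 : ℝ) < (F.P K).L := by exact_mod_cast (F.P K).L_pos
  unfold Params.eta
  positivity

end Eta

/-! ## §2  At print's (1.74) object: the rows (E) and (T1@q₀) for EVERY base field of the strict guard, from the two [15] letters READ AT THE INSTANCES' OWN LENGTHS `k i` (the lane's `_pos` §2, verbatim but for the two letter binders and their two calls) -/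

section AtZ

open Classical
open Metric
open B14DomainGeom (IsUnionOfCubes)
open B15Eq112TorusCover (cover)
open B14.Eq213MaximalDomains (side)
open B14.Eq213DetSet B15Sect1Instances B16Sect1Wilson B16Sect1Backgrounds
open T4CubeChartGnomonic (SU2)
open T4AxialGaugeSmallField (castSite boxPlaqs)
open B15Extension193 (extend)
open B15ShellGauge193 (shellGauge)
open B15ShellGauge193Local (dist1_plaqHol_extend_shellGauge_le)

/-- ★★★ **THE ROWS (E) AND (T1@q₀) OF «(J0′) OF RECORD» FOR EVERY BASE FIELD OF THE STRICT GUARD, FROM THE TWO [15] LETTERS READ AT EACH INSTANCE's OWN LENGTH — AT-LENGTH EDITION** of the lane's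
`B15Prop1Thm1RowsOfExistsUniquePos.thm1Rows_atZ_of_thm1TorusClass_existsUnique_pos`: K0⁷'s (8)-letter `h15T` ([15] Thm 1 (R) over NODE 00's torus class of `LʲM₁`-cube unions at `(ν, Kt)`) and the
EXISTENCE ∕ UNIQUENESS letter `h15EUT` (conclusion «∃ minimiser over class (6) at `ε₀`» ∧ «any two minimisers differ by a gauge with equal, central scale-`j` images at the two ends of every
constrained bond»), EACH STATED PER INSTANCE `i` AT THE LENGTH `k i` ONLY (`∀ i, ∀ s : Seq … (k i), …`; the `_pos` bodies with `k'` read as `k i`; the rows `k i ≤ m + K`, `0 < k i`,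
`L^{k i}M₁ ∣ sitesPerDir 0` are the displayed instance rows `hk` ∕ `hk0` ∕ `hdiv`) — so that a producer guarded in the length (the K0 road's grid-guarded (8)-token
`Node00.VariationalThm1RegSepCoP7MG F 2 A‴ B₃ a₀ a₁`) serves exactly the instances passing its guard.  Per instance `i` of the knit (`Z, Λ, k, lo, hi, ext`: the geometry rows of
`nearValue_letter_of_thm1Guarded` VERBATIM), for every `0 < ε` with `(c_E+1)ε ≤ a₁`, every class tolerance `εr ≥ B₃(c_E+1)ε`, every `ε₀` with `εr < ε₀ ≤ a₀`, and every base field `V_k` with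
`PlaqSmallOn (plaqsInside (pts k (Z ∩ Λᶜ))) ε V_k`:
(E) `∃ U₀, IsMinimizer (M˙) (U_k({Ω_j(Z)}, εr)) (𝐁_k(Z)) (M˙(Q_k^{s*}(ext V_k))) U₀` — U2 :171–173 VERBATIM at `ν⟨εreg := εr⟩` — and, for EVERY such minimiser `U₀`,
(T1@q₀) over `reg' := closure (U_k({Ω_j(Z)}, εr))` — dag-n12-d (A″) :196–200 VERBATIM.
Proof: the lane's `_pos` proof verbatim but for the two letter calls. [cite: Balaban1985Variational, (1) p.277, (2),(3),(5),(6),(7) p.278, Thm 1 (8) p.279; Balaban1988Convergent, (2.1) p.254, p.255, (2.12)–(2.13) pp.256–257, (2.18) p.257; Balaban1989LargeFieldI, (1.74) p.192, p.193 ll.14–20, Prop. 1 p.194; Balaban1989LargeFieldII, (1.12)–(1.13) p.359; Balaban1985RegularSpaces, (1.3)–(1.9) p.77] -/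
theorem thm1Rows_atZ_of_thm1TorusClass_existsUnique_atLength {F : T4Family} (ν : Node00.Stage7Numerics) (Kt : ℕ) (hd3 : 3 ≤ (F.P Kt).d) {ι : Type}
    (Z Λ : ι → Set (Site (F.P Kt) 0)) (k : ι → ℕ) (hk0 : ∀ i, 0 < k i) (hk : ∀ i, k i ≤ (F.P Kt).m + (F.P Kt).K)
    (lo hi : ι → Fin (F.P Kt).d → ℤ) (n : ι → ℕ) (hn : ∀ i κ, hi i κ ≤ lo i κ + n i)
    (hbox : ∀ i, pts (k i) (Λ i) = (castSite '' Set.Icc (lo i) (hi i) : Set (Site (F.P Kt) (k i))))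
    (hZ : ∀ i, (boxPlaqs (lo i - 1) (hi i + 1) : Set (Plaq (F.P Kt) (k i))) ⊆ plaqsInside (pts (k i) (Z i)))
    (hN5 : ∀ i κ, ((hi i κ - lo i κ + 1).toNat : ℤ) + 5 < (F.P Kt).sitesPerDir (k i))
    (ext : ∀ i, GaugeField (F.P Kt) (k i) SU2 → GaugeField (F.P Kt) (k i) SU2)
    (hext : ∀ i Vk, ext i Vk = extend (pts (k i) (Λ i)) (shellGauge Vk (lo i) (hi i)) Vk)
    (hlohi : ∀ i, lo i ≤ hi i)
    -- (Gᵃ) geometry of `Z`: a union of `k`-blocks; print's `M₁ ≥ 2` and the torus divisibility of the `LʲM₁`-cube partitions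
    (hZblk : ∀ i, IsBlockUnion (k i) (Z i))
    (hM2 : 2 ≤ ν.M₁) (hdiv : ∀ i, side (F.P Kt).L ν.M₁ (k i) ∣ (F.P Kt).sitesPerDir 0)
    -- bookkeeping constants
    {cE B₃ a₀ a₁ : ℝ} (hcE0 : 0 ≤ cE) (hcE : ∀ i, 12 * ((F.P Kt).d : ℝ) * ((n i : ℝ) + 2) ^ 2 ≤ cE)
    -- [15] THEOREM 1 (R) = (8) OVER NODE 00's TORUS CLASS (shape (C)), READ AT EACH INSTANCE's OWN LENGTH `k i` (served by the K0 road's grid-guarded (8)-token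
    -- `Node00.VariationalThm1RegSepCoP7MG F 2 A‴ B₃ a₀ a₁` at instances passing the guard — dag-n12-d `BalabanUVNodesN12Thm1LettersAtLengthOfK0GridG`; by the `_pos` letter at every instance)
    (h15T : ∀ (i : ι) (s : B14.Eq218Concrete.Seq (fun n : ℕ => Node00.unionsOfCubes (F.P Kt) (side (F.P Kt).L ν.M₁ n)) (k i)),
      Node00.Sect2.SeqSeparated ν.M₁ s → 0 < ν.M₁ →
      ∀ (ε₀ : ℝ) (δ : ℕ → ℝ), (∀ j, j ≤ k i → 0 < δ j ∧ δ j ≤ a₁ ∧ B₃ * δ j ≤ ε₀) → (∀ j, j < k i → δ j ≤ 2 * δ (j + 1)) →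
      (∀ j, j < k i → δ (j + 1) ≤ 2 * δ j) → ε₀ ≤ a₀ →
      ∀ W : MSField (F.P Kt) SU2,
        Node00.Sect2.DataSmall7PTop (Node00.avOfRecord F 2 Kt) s.Ω (Node00.suppDomOfRecord F ν Kt s.Ω) (k i) δ W →
        ∀ U₀ : GaugeField (F.P Kt) 0 SU2, IsMinimizer (Node00.avOfRecord F 2 Kt)
            {U | (∀ j, j ≤ k i → PlaqSmallOn (Node00.Sect2.omegaPlaqsTop s.Ω (Node00.suppDomOfRecord F ν Kt s.Ω) j)
                (ε₀ * (F.P Kt).eta j ^ 2) U) ∧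
              Node00.Sect2.CoDivClassOnTop s.Ω (Node00.suppDomOfRecord F ν Kt s.Ω) (k i) ε₀ U}
            (genSet s.Ω (k i)) W U₀ →
          (∀ j, j ≤ k i → PlaqSmallOn (Node00.Sect2.omegaPlaqsTop s.Ω (Node00.suppDomOfRecord F ν Kt s.Ω) j)
              (B₃ * δ j * (F.P Kt).eta j ^ 2) U₀) ∧
            ∀ j, j ≤ k i → Node00.Sect2.CoDivSmallOn (Node00.Sect2.omegaBondsTop s.Ω (Node00.suppDomOfRecord F ν Kt s.Ω) j)
              (B₃ * δ j * (F.P Kt).eta j ^ 3) U₀)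
    -- [15] THEOREM 1, EXISTENCE OF THE MINIMAL ORBIT ∕ UNIQUENESS MODULO TOWER-CENTRAL GAUGES OVER NODE 00's TORUS CLASS, READ AT EACH INSTANCE's OWN LENGTH `k i ≥ 1` (no producer in the tree)
    (h15EUT : ∀ (i : ι) (s : B14.Eq218Concrete.Seq (fun n : ℕ => Node00.unionsOfCubes (F.P Kt) (side (F.P Kt).L ν.M₁ n)) (k i)),
      Node00.Sect2.SeqSeparated ν.M₁ s → 0 < ν.M₁ →
      ∀ (ε₀ : ℝ) (δ : ℕ → ℝ), (∀ j, j ≤ k i → 0 < δ j ∧ δ j ≤ a₁ ∧ B₃ * δ j ≤ ε₀) → (∀ j, j < k i → δ j ≤ 2 * δ (j + 1)) →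
      (∀ j, j < k i → δ (j + 1) ≤ 2 * δ j) → ε₀ ≤ a₀ →
      ∀ W : MSField (F.P Kt) SU2,
        Node00.Sect2.DataSmall7PTop (Node00.avOfRecord F 2 Kt) s.Ω (Node00.suppDomOfRecord F ν Kt s.Ω) (k i) δ W →
        (∃ U₀ : GaugeField (F.P Kt) 0 SU2, IsMinimizer (Node00.avOfRecord F 2 Kt)
            {U | (∀ j, j ≤ k i → PlaqSmallOn (Node00.Sect2.omegaPlaqsTop s.Ω (Node00.suppDomOfRecord F ν Kt s.Ω) j)
                (ε₀ * (F.P Kt).eta j ^ 2) U) ∧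
              Node00.Sect2.CoDivClassOnTop s.Ω (Node00.suppDomOfRecord F ν Kt s.Ω) (k i) ε₀ U}
            (genSet s.Ω (k i)) W U₀) ∧
        ∀ U₁ U₂ : GaugeField (F.P Kt) 0 SU2,
          IsMinimizer (Node00.avOfRecord F 2 Kt)
            {U | (∀ j, j ≤ k i → PlaqSmallOn (Node00.Sect2.omegaPlaqsTop s.Ω (Node00.suppDomOfRecord F ν Kt s.Ω) j)
                (ε₀ * (F.P Kt).eta j ^ 2) U) ∧
              Node00.Sect2.CoDivClassOnTop s.Ω (Node00.suppDomOfRecord F ν Kt s.Ω) (k i) ε₀ U}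
            (genSet s.Ω (k i)) W U₁ →
          IsMinimizer (Node00.avOfRecord F 2 Kt)
            {U | (∀ j, j ≤ k i → PlaqSmallOn (Node00.Sect2.omegaPlaqsTop s.Ω (Node00.suppDomOfRecord F ν Kt s.Ω) j)
                (ε₀ * (F.P Kt).eta j ^ 2) U) ∧
              Node00.Sect2.CoDivClassOnTop s.Ω (Node00.suppDomOfRecord F ν Kt s.Ω) (k i) ε₀ U}
            (genSet s.Ω (k i)) W U₂ →
          ∃ u : GaugeTransf (F.P Kt) 0 SU2,
            (∀ j, j ≤ k i → ∀ b ∈ bondsOf (genSet s.Ω (k i) j), toMS u j b.src = toMS u j b.tgt ∧ ∀ g : SU2, toMS u j b.src * g = g * toMS u j b.src) ∧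
              gaugeAct u U₁ = U₂) :
    ∀ i (εr ε₀ ε : ℝ) (Vk : GaugeField (F.P Kt) (k i) SU2), 0 < ε → (cE + 1) * ε ≤ a₁ → B₃ * ((cE + 1) * ε) ≤ εr → εr < ε₀ → ε₀ ≤ a₀ →
      PlaqSmallOn (plaqsInside (pts (k i) (Z i ∩ (Λ i)ᶜ))) ε Vk →
      (∃ U₀ : GaugeField (F.P Kt) 0 SU2,
          IsMinimizer (Node00.avOfRecord F 2 Kt) (Node00.regMSCoPOfRecord F 2 {ν with εreg := εr} Kt (k i) (maxDomT ν.M₁ (Z i))) (Bj ν.M₁ (Z i) (k i))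
            (avgFamily (Node00.avOfRecord F 2 Kt) (qsstarGIter0 (k i) (ext i Vk))) U₀) ∧
      ∀ U₀ : GaugeField (F.P Kt) 0 SU2,
        IsMinimizer (Node00.avOfRecord F 2 Kt) (Node00.regMSCoPOfRecord F 2 {ν with εreg := εr} Kt (k i) (maxDomT ν.M₁ (Z i))) (Bj ν.M₁ (Z i) (k i))
            (avgFamily (Node00.avOfRecord F 2 Kt) (qsstarGIter0 (k i) (ext i Vk))) U₀ →
        ∀ U ∈ closure (Node00.regMSCoPOfRecord F 2 {ν with εreg := εr} Kt (k i) (maxDomT ν.M₁ (Z i))),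
          AgreeOn (Bj ν.M₁ (Z i) (k i)) (avgFamily (Node00.avOfRecord F 2 Kt) U) (avgFamily (Node00.avOfRecord F 2 Kt) (qsstarGIter0 (k i) (ext i Vk))) →
          wilsonAction4 U ≤ wilsonAction4 U₀ →
            ∃ u : GaugeTransf (F.P Kt) 0 SU2,
              (∀ j, j ≤ k i → ∀ b ∈ bondsOf (Bj ν.M₁ (Z i) (k i) j), toMS u j b.src = toMS u j b.tgt ∧ ∀ g : SU2, toMS u j b.src * g = g * toMS u j b.src) ∧
                gaugeAct u U = U₀ := by
  intro i εr ε₀ ε Vk hε hεa₁ hεr hr₀ ha₀ hreg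
  have hd : 2 ≤ (F.P Kt).d := by omega
  have hM : 1 ≤ ν.M₁ := le_trans one_le_two hM2
  have hki : 1 ≤ k i := hk0 i
  -- `Z`'s maximal sequence as a separated (2.18) index, with print's cube letters, re-indexed over NODE 00's torus class
  obtain ⟨s, hsΩ, -, hscube, hsep⟩ := exists_seq_maxDomT hM (Z i) (hdiv i)
  obtain ⟨s', hΩ'⟩ := exists_seq_torusClass_of_cubeLetters hM s hscube
  have hsep' : Node00.Sect2.SeqSeparated ν.M₁ s' := (seqSeparated_iff_of_Ω_eq ν.M₁ hΩ').2 hsep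
  have hw1 : s.Ω 1 = maxDomT ν.M₁ (Z i) 1 := hsΩ 1 le_rfl hki
  -- (a) the p. 193 extension is `(cE+1)ε`-small on the `k`-plaquettes inside `Z`
  have hN3 : ∀ κ, hi i κ - lo i κ + 3 < ((F.P Kt).sitesPerDir (k i) : ℤ) := fun κ => by
    have h5 := hN5 i κ
    have hle : lo i κ ≤ hi i κ := hlohi i κ
    rw [Int.toNat_of_nonneg (by linarith)] at h5
    linarith
  have hδ₀ : 0 < (cE + 1) * ε := by positivity
  have hV : PlaqSmallOn (plaqsInside (pts (k i) (Z i))) ((cE + 1) * ε) (ext i Vk) := by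
    intro p hp
    rw [hext]
    have h := (dist1_plaqHol_extend_shellGauge_le hd3 (hlohi i) (hn i) hN3 (hbox i) (hZ i) hε hreg).1 p hp
    calc dist1 (plaqHol (extend (pts (k i) (Λ i)) (shellGauge Vk (lo i) (hi i)) Vk) p)
        ≤ 12 * (F.P Kt).d * (n i + 2) ^ 2 * ε := h
      _ ≤ cE * ε := mul_le_mul_of_nonneg_right (hcE i) hε.le
      _ < (cE + 1) * ε := by nlinarith
  -- (b) print's (7) for the datum ALONG THE INDEX `s.Ω`
  have h0 : Node00.Sect2.printedPlaqsTop s.Ω (Node00.suppDomOfRecord F ν Kt s.Ω) (k i) ⊆ plaqsInside (Z i) := by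
    rw [printedPlaqsTop_congr hki hsΩ, Node00.suppDomOfRecord_congr (F := F) ν Kt hw1]
    exact printedPlaqsTop_maxDomT_subset_plaqsInside hM (hdiv i) hki (k i)
  have hsucc : ∀ m, m + 1 ≤ k i → Node00.Sect2.printedPlaqs s.Ω (k i) (m + 1) ⊆ plaqsInside (pts (m + 1) (Z i)) := by
    intro m hm
    refine (Node00.Sect2.printedPlaqs_subset_plaqsOf _ _ _).trans ?_
    refine (plaqsOf_mono (genSet_subset_pts_of_one_le s.Ω (k i) (Nat.succ_pos m))).trans ?_
    rw [hsΩ (m + 1) (Nat.succ_pos m) hm]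
    exact plaqsOf_pts_maxDomT_subset_plaqsInside hM2 (hdiv i) (Nat.succ_pos m) hm
  have h7 : Node00.Sect2.DataSmall7PTop (Node00.avOfRecord F 2 Kt) s.Ω (Node00.suppDomOfRecord F ν Kt s.Ω) (k i)
      (fun _ => (cE + 1) * ε) (avgFamily (Node00.avOfRecord F 2 Kt) (qsstarGIter0 (k i) (ext i Vk))) :=
    dataSmall7PTop_avgFamily_qsstarGIter0 hd ExpMeanLog.expMeanLogSU T3DescentFibreTower.expMeanLogSU_E_one rfl (hk i)
      s.Ω _ (Z i) (hZblk i) h0 hsucc (fun _ _ => hδ₀) (ext i Vk) (fun _ _ => hV)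
  -- numerics of the thresholds at `ε₀`
  have hnum : ∀ j, j ≤ k i → 0 < (cE + 1) * ε ∧ (cE + 1) * ε ≤ a₁ ∧ B₃ * ((cE + 1) * ε) ≤ ε₀ := fun j _ =>
    ⟨hδ₀, hεa₁, hεr.trans hr₀.le⟩
  -- the two [15] letters AT THIS INSTANCE's LENGTH at the index `s'`, read back at `s.Ω`, applied to the (1.74) datum
  have h8 := h15T i s' hsep' hM
  have hEU := h15EUT i s' hsep' hM
  rw [hΩ'] at h8 hEU
  have h8W := h8 ε₀ (fun _ => (cE + 1) * ε) hnum (fun _ _ => by linarith) (fun _ _ => by linarith) ha₀ _ h7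
  obtain ⟨⟨Ustar, hUstar⟩, huniq⟩ := hEU ε₀ (fun _ => (cE + 1) * ε) hnum (fun _ _ => by linarith) (fun _ _ => by linarith) ha₀ _ h7
  clear h8 hEU
  -- (c) the (1.74) class and determining set at `maxDomT ν.M₁ Z` ARE those at the index `s`; the class literal at `ε₀` IS the class of record at `ν⟨εreg := ε₀⟩`
  rw [setOf_class_eq_regMSCoPOfRecord] at hUstar huniq h8W
  have hreg : ∀ e : ℝ, Node00.regMSCoPOfRecord F 2 {ν with εreg := e} Kt (k i) (maxDomT ν.M₁ (Z i)) =
      Node00.regMSCoPOfRecord F 2 {ν with εreg := e} Kt (k i) s.Ω := fun e => (regMSCoPOfRecord_congr F 2 _ Kt hki hsΩ).symm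
  have hB : Bj ν.M₁ (Z i) (k i) = genSet s.Ω (k i) := (genSet_congr hki hsΩ).symm
  -- the `ε₀`-minimiser `U*` is `B₃(cE+1)ε`-regular, hence in the class at `εr`
  have h8U := h8W Ustar hUstar
  have hUr : Ustar ∈ Node00.regMSCoPOfRecord F 2 {ν with εreg := εr} Kt (k i) s.Ω := by
    refine ⟨fun j hj p hp => ((h8U.1 j hj) p hp).trans_le ?_, fun j hj b hb => ((h8U.2 j hj) b hb).trans_le ?_⟩
    · exact mul_le_mul_of_nonneg_right hεr (pow_nonneg (eta_pos Kt j).le 2)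
    · exact mul_le_mul_of_nonneg_right hεr (pow_nonneg (eta_pos Kt j).le 3)
  have hsub : Node00.regMSCoPOfRecord F 2 {ν with εreg := εr} Kt (k i) s.Ω ⊆ Node00.regMSCoPOfRecord F 2 {ν with εreg := ε₀} Kt (k i) s.Ω :=
    regMSCoPOfRecord_mono_eps ν Kt (k i) s.Ω hr₀.le
  have hcl : closure (Node00.regMSCoPOfRecord F 2 {ν with εreg := εr} Kt (k i) s.Ω) ⊆ Node00.regMSCoPOfRecord F 2 {ν with εreg := ε₀} Kt (k i) s.Ω :=
    closure_regMSCoPOfRecord_subset_of_lt ν Kt (k i) s.Ω hr₀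
  refine ⟨⟨Ustar, ?_⟩, ?_⟩
  · -- (E) at `εr`
    rw [hreg εr, hB]
    exact isMinimizer_of_mem_of_subset (Node00.avOfRecord F 2 Kt) hUstar hsub hUr
  · -- (T1@q₀) at `εr`, for every minimiser `U₀`
    intro U₀ hU₀ U hU hUW hle
    rw [hreg εr, hB] at hU₀
    rw [hreg εr] at hU
    rw [hB] at hUW ⊢
    exact thm1Row_of_existsUnique (Node00.avOfRecord F 2 Kt)
      (fun U₁ U₂ => ∃ u : GaugeTransf (F.P Kt) 0 SU2,
        (∀ j, j ≤ k i → ∀ b ∈ bondsOf (genSet s.Ω (k i) j), toMS u j b.src = toMS u j b.tgt ∧ ∀ g : SU2, toMS u j b.src * g = g * toMS u j b.src) ∧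
          gaugeAct u U₁ = U₂)
      hsub hcl ⟨Ustar, hUstar, hUr⟩ huniq hU₀ U hU hUW hle

end AtZ

end Literature.MathematicalPhysics.QuantumFieldTheory.Balaban1983to89.B15Prop1Thm1RowsOfExistsUniqueAtLength

end
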